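import Summits.RiemannHypothesis.RiemannHypothesis.Theorems.PfPersistenceBarrierPolePair
import Summits.RiemannHypothesis.RiemannHypothesis.Theorems.PfPersistencePoleFreeIndex
import HarnessLib

/-!
# PF-persistence barrier: two-parity INDEX COMPARISON readers are walled (PROVED, RH-free)

Framing (page 1 of every `pub-rhpf` file): **long-odds MECHANISM / RIGIDITY SEARCH — nothing here is
a claim about RH.**  Every statement below is RH-free; `RiemannHypothesis` is never a hypothesis or a
conclusion.

The harness instrument `cand7-016` (EVLEODD) reads the bit `n₋^ev(A) ≤ n₋^odd(A)` — "the even block of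
the window form has at most as many negative directions as the odd block".  This file types the two
index comparisons in Galerkin / Courant form and places them inside the two-parity monotone walls of
`…BarrierPolePair`:

* `OddSubIndexOn R k F A` — the odd twin of `SubIndexOn` (`…PoleFreeIndex`): the ODD window form of `F`
  dominates the reference functional `R` on the common kernel of `k` ℂ-linear functionals
  ("at most `k` odd directions below `R`"); it is odd-monotone (`oddSubIndexOn_isOddMonotone`).
* `EvenIndexLEOddOn R F A := ∀ k, OddSubIndexOn R k F A → SubIndexOn R k F A` ("even index ≤ odd
  index", level by level) is (even up, odd down)-monotone ⇒ **`no_evenIndexLEOdd_discriminator`**: on any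
  set of cutoffs, with any cutoff-dependent reference, it does not discriminate `ζ` from a negative
  class containing the non-Weil-positive data (the planted real ZERO pair passes it whenever `ζ` does).
* `OddIndexLEEvenOn R F A` (the reverse comparison) is (even down, odd up)-monotone ⇒
  **`no_oddIndexLEEven_discriminator`** (the planted real POLE pair passes it whenever `ζ` does).
* `no_oddSubIndex_discriminator`: odd sub-index criteria alone (odd floors at several levels) are
  odd-monotone, hence walled.

So BOTH one-sided comparisons of the two parity indices are blind, each to one of the two provably
non-Weil-positive real-pair controls; only readers non-monotone in some parity block (e.g. the
equality of the two indices, or shape criteria) fall outside these walls — and the equality reader is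
blind for a different, already PROVED reason (on finite off-line quadruple worlds the deep-window even
and odd indices both equal `K`, `…TwoParityIndexFamilies/Levels`).  References: Bombieri 2000 (explicit
formula, Thm 2); Weil 1952; Courant–Fischer (Galerkin reading of "index ≤ k").
-/

set_option linter.dupNamespace false

noncomputable section

open Set MeasureTheory Complex
open scoped Real

namespace Summit.RiemannHypothesis.RiemannHypothesis.Theorems.PfPersistenceBarrier

open Literature.NumberTheory.LFunctions
open ExplicitDatum

/-! ## The odd sub-index schema -/

/-- `OddSubIndexOn R k F A`: the ODD window form of `F` at cutoff `A` dominates the reference functional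
`R` on the common kernel of `k` ℂ-linear functionals (Galerkin reading: at most `k` odd directions of the
window lie below `R`; `R = 0`: odd negative index `≤ k`).  Odd twin of `SubIndexOn`. [folklore] -/
def OddSubIndexOn (R : (ℝ → ℂ) → ℝ) (k : ℕ) (F : ExplicitDatum) (A : ℝ) : Prop :=
  ∃ ℓ : Fin k → ((ℝ → ℂ) →ₗ[ℂ] ℂ), ∀ g : ℝ → ℂ, IsWeilTest g → IsOdd g → tsupport g ⊆ Icc (-A) A →
    (∀ i, ℓ i g = 0) → R g ≤ (F.quadratic g).re

/-- Codimension `0` is a plain odd floor `R ≤ Re Q_F` on the odd tests of the window. [folklore] -/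
theorem oddSubIndexOn_zero_iff (R : (ℝ → ℂ) → ℝ) (F : ExplicitDatum) (A : ℝ) :
    OddSubIndexOn R 0 F A ↔ ∀ g : ℝ → ℂ, IsWeilTest g → IsOdd g → tsupport g ⊆ Icc (-A) A →
      R g ≤ (F.quadratic g).re := by
  constructor
  · rintro ⟨ℓ, hℓ⟩ g hg ho hs
    exact hℓ g hg ho hs fun i ↦ i.elim0
  · intro h
    exact ⟨fun i ↦ i.elim0, fun g hg ho hs _ ↦ h g hg ho hs⟩

/-- Raising the codimension weakens the criterion. [folklore] -/
theorem OddSubIndexOn.mono {R : (ℝ → ℂ) → ℝ} {k k' : ℕ} {F : ExplicitDatum} {A : ℝ}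
    (h : OddSubIndexOn R k F A) (hk : k ≤ k') : OddSubIndexOn R k' F A := by
  obtain ⟨ℓ, hℓ⟩ := h
  refine ⟨fun i ↦ if hi : (i : ℕ) < k then ℓ ⟨i, hi⟩ else 0, fun g hg ho hs h0 ↦ hℓ g hg ho hs ?_⟩
  intro i
  have := h0 ⟨i, lt_of_lt_of_le i.isLt hk⟩
  simpa [i.isLt] using this

/-- **PROVED**: an odd sub-index criterion at one cutoff is odd-monotone. [folklore] -/
theorem oddSubIndexOn_isOddMonotone (R : (ℝ → ℂ) → ℝ) (k : ℕ) (A : ℝ) :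
    IsOddMonotone fun F ↦ OddSubIndexOn R k F A := by
  rintro F G hFG ⟨ℓ, hℓ⟩
  exact ⟨ℓ, fun g hg ho hs h0 ↦ (hℓ g hg ho hs h0).trans (hFG g hg ho)⟩

/-- **WALL (ODD SUB-INDEX, PROVED, RH-free, binder-free)**: cutoff-dependent odd sub-index criteria
(odd floors below several levels) on any set of cutoffs do not discriminate `ζ` from a negative class
containing the non-Weil-positive data. [folklore] -/
theorem no_oddSubIndex_discriminator (R : ℝ → (ℝ → ℂ) → ℝ) (k : ℝ → ℕ) (S : Set ℝ)
    {Neg : Set ExplicitDatum} (hNeg : {F : ExplicitDatum | ¬ F.Positivity} ⊆ Neg) :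
    ¬ Discriminates (fun F ↦ ∀ A ∈ S, OddSubIndexOn (R A) (k A) F A) zetaDatum Neg :=
  no_oddMonotone_discriminator (P := fun F ↦ ∀ A ∈ S, OddSubIndexOn (R A) (k A) F A)
    (fun F G hFG hF A hA ↦ oddSubIndexOn_isOddMonotone (R A) (k A) A F G hFG (hF A hA)) hNeg

/-! ## The two index comparisons -/

namespace ExplicitDatum

/-- "EVEN INDEX ≤ ODD INDEX" relative to the reference `R`, level by level (Galerkin form of the harness
bit `n₋^ev(A) ≤ n₋^odd(A)` at `R = 0`): whenever at most `k` odd directions of the window lie below `R`,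
at most `k` even directions do. [folklore] -/
def EvenIndexLEOddOn (R : (ℝ → ℂ) → ℝ) (F : ExplicitDatum) (A : ℝ) : Prop :=
  ∀ k : ℕ, OddSubIndexOn R k F A → SubIndexOn R k F A

/-- "ODD INDEX ≤ EVEN INDEX" relative to `R`, level by level. [folklore] -/
def OddIndexLEEvenOn (R : (ℝ → ℂ) → ℝ) (F : ExplicitDatum) (A : ℝ) : Prop :=
  ∀ k : ℕ, SubIndexOn R k F A → OddSubIndexOn R k F A

end ExplicitDatum

/-- **PROVED**: "even index ≤ odd index" is (even up, odd down)-monotone — raising the even block can only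
remove even directions below `R`, lowering the odd block can only add odd ones. [folklore] -/
theorem evenIndexLEOddOn_isEvenUpOddDownMonotone (R : (ℝ → ℂ) → ℝ) (A : ℝ) :
    IsEvenUpOddDownMonotone fun F ↦ F.EvenIndexLEOddOn R A :=
  fun F G hFG hGF hF k hGk ↦
    subIndexOn_isEvenMonotone R k A F G hFG (hF k (oddSubIndexOn_isOddMonotone R k A G F hGF hGk))

/-- **PROVED**: "odd index ≤ even index" is (even down, odd up)-monotone. [folklore] -/
theorem oddIndexLEEvenOn_isEvenDownOddUpMonotone (R : (ℝ → ℂ) → ℝ) (A : ℝ) :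
    IsEvenDownOddUpMonotone fun F ↦ F.OddIndexLEEvenOn R A :=
  fun F G hGF hFG hF k hGk ↦
    oddSubIndexOn_isOddMonotone R k A F G hFG (hF k (subIndexOn_isEvenMonotone R k A G F hGF hGk))

/-- **WALL (EVEN INDEX ≤ ODD INDEX; PROVED, RH-free, binder-free)**: with any cutoff-dependent reference
`R` and on any set of cutoffs `S` (all `a`, a served grid, a tail), the comparison does not discriminate
`ζ` from a negative class containing the non-Weil-positive data: the planted real ZERO pair
`realPairDatum 1` (PROVABLY not Weil-positive, `not_positivity_realPairDatum`) passes it whenever `ζ`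
does.  Typed wall behind the harness instrument `cand7-016`. [folklore] -/
theorem no_evenIndexLEOdd_discriminator (R : ℝ → (ℝ → ℂ) → ℝ) (S : Set ℝ) {Neg : Set ExplicitDatum}
    (hNeg : {F : ExplicitDatum | ¬ F.Positivity} ⊆ Neg) :
    ¬ Discriminates (fun F ↦ ∀ A ∈ S, F.EvenIndexLEOddOn (R A) A) zetaDatum Neg :=
  no_evenUpOddDown_discriminator
    (IsEvenUpOddDownMonotone.all fun A ↦ IsEvenUpOddDownMonotone.all fun _ ↦
      evenIndexLEOddOn_isEvenUpOddDownMonotone (R A) A) hNeg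

/-- **WALL (ODD INDEX ≤ EVEN INDEX; PROVED, RH-free, binder-free)**: the reverse comparison does not
discriminate either — the planted real POLE pair `polePairDatum 1` (PROVABLY not Weil-positive,
`not_positivity_polePairDatum`) passes it whenever `ζ` does. [folklore] -/
theorem no_oddIndexLEEven_discriminator (R : ℝ → (ℝ → ℂ) → ℝ) (S : Set ℝ) {Neg : Set ExplicitDatum}
    (hNeg : {F : ExplicitDatum | ¬ F.Positivity} ⊆ Neg) :
    ¬ Discriminates (fun F ↦ ∀ A ∈ S, F.OddIndexLEEvenOn (R A) A) zetaDatum Neg :=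
  no_evenDownOddUp_discriminator
    (IsEvenDownOddUpMonotone.all fun A ↦ IsEvenDownOddUpMonotone.all fun _ ↦
      oddIndexLEEvenOn_isEvenDownOddUpMonotone (R A) A) hNeg

/-- **PROVED**: at the planted real zero pair the comparison "even index ≤ odd index" holds at every
cutoff where `ζ` has it (transfer instance, any reference). [folklore] -/
theorem realPairDatum_evenIndexLEOddOn {R : (ℝ → ℂ) → ℝ} {A : ℝ}
    (hζ : zetaDatum.EvenIndexLEOddOn R A) (η : ℝ) : (realPairDatum η).EvenIndexLEOddOn R A :=
  realPair_of_isEvenUpOddDownMonotone (evenIndexLEOddOn_isEvenUpOddDownMonotone R A) hζ η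

/-- **PROVED**: at the planted real pole pair the comparison "odd index ≤ even index" holds at every
cutoff where `ζ` has it. [folklore] -/
theorem polePairDatum_oddIndexLEEvenOn {R : (ℝ → ℂ) → ℝ} {A : ℝ}
    (hζ : zetaDatum.OddIndexLEEvenOn R A) (η : ℝ) : (polePairDatum η).OddIndexLEEvenOn R A :=
  polePair_of_isEvenDownOddUpMonotone (oddIndexLEEvenOn_isEvenDownOddUpMonotone R A) hζ η


end Summit.RiemannHypothesis.RiemannHypothesis.Theorems.PfPersistenceBarrier
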